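import Summits.MatrixMultiplication.MatrixMultiplication.Theorems.SoloInformedCwTwoCayleyCensus
import HarnessLib

/-!
# The orbit-tangent rank of a tensor in `K^ι ⊗ K^ι ⊗ K^ι` (every characteristic)

Solo programme `solo-MatrixMultiplication-informed`, generation 28: the generic-index version of
`SoloInformedOrbitRank` (`ι = {0,1,2}`, three blocks), used by `SoloInformedConverseDoorTwo`.

* `OrbitRankGen.orbitForm T` — the `|ι|³ × 2|ι|²` matrix of the infinitesimal action
  `gl(K^ι) ⊕ gl(K^ι) → K^ι ⊗ K^ι ⊗ K^ι`, `(X, Y) ↦ X·₁T + Y·₂T` of the first two factors; column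
  `(f, p, q)` is `E_{pq}` acting in factor `f` (`orbitForm_apply`); a MATRIX rank, in every char.
* **Equivariance** (`kronT_mul_orbitForm_mul`, Kronecker algebra; block `Y` by transporting block
  `X` along the factor swap): `(A ⊗ B ⊗ C)ᵀ · O_T · Φ = O_{(A,B,C)·T} · D` with
  `Φ = adj(Aᵀ) ⊗ A ⊕ adj(Bᵀ) ⊗ B`, `D = det A · 1 ⊕ det B · 1`; so substitutions invertible in the
  first two factors do not increase `rank O` (`rank_orbitForm_tsub_le`), and by the perturbation
  argument (`A + X^m · 1` is invertible for one `m` among `3|ι| + 1` consecutive exponents,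
  `exists_pert_det_ne_zero`) neither do degenerations (`rank_orbitForm_le_of_polyDegeneratesTo`).
Sources: [cite: Alman2021, §2.4]; [cite: ConnerGesmundoLandsbergVentura2022, §3.2]. All PROVED.
-/

namespace Summit.MatrixMultiplication.MatrixMultiplication.Theorems

open Matrix Polynomial Finset
open Literature.Computability.AlgebraicComplexity Literature.Barriers.MatrixMultiplication
open Literature.LinearAlgebra.Matrix
open scoped Kronecker Polynomial

universe u

set_option linter.unusedSectionVars false

namespace OrbitRankGen

/-- Triple indices `ι³` (the basis of `K^ι ⊗ K^ι ⊗ K^ι`). [folklore] -/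
abbrev Tri (ι : Type) : Type := ι × ι × ι

/-- Column indices `(f, p, q)`: the elementary matrix `E_{pq}` in factor `f ∈ {0,1}`. [folklore] -/
abbrev Col (ι : Type) : Type := Fin 2 × ι × ι

variable {ι : Type} [Fintype ι] [DecidableEq ι]

/-! ## The orbit form on a general index type -/

section Form

variable {R : Type*} [CommRing R]

/-- The substituted tensor `((A,B,C)·T)_{abc} = Σ_{xyz} T_{xyz} A_{xa} B_{yb} C_{zc}`.
[cite: Alman2021, §2.4] -/
def tsub (T : ι → ι → ι → R) (A B C : ι → ι → R) : ι → ι → ι → R :=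
  fun a b c => ∑ v : Tri ι, T v.1 v.2.1 v.2.2 * (A v.1 a * B v.2.1 b * C v.2.2 c)

/-- `polySubst` is `tsub` of the constant tensor. [cite: Alman2021, §2.4] -/
theorem polySubst_eq_tsub {K : Type*} [CommRing K] (t : ι → ι → ι → K) (A B C : ι → ι → K[X]) :
    polySubst t A B C = tsub (fun a b c => Polynomial.C (t a b c)) A B C := by
  funext a b c
  simp only [polySubst, tsub, Fintype.sum_prod_type]

/-- The first flattening `(flat T)_{q,(b,c)} = T_{qbc}`. [folklore] -/
def flat (T : ι → ι → ι → R) : Matrix ι (ι × ι) R := Matrix.of fun q bc => T q bc.1 bc.2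

/-- The `X`-block: column `(p, q)` is `E_{pq} ·₁ T`. [folklore] -/
def oblkX (T : ι → ι → ι → R) : Matrix (Tri ι) (ι × ι) R := (1 : Matrix ι ι R) ⊗ₖ (flat T)ᵀ

/-- Entries of the `X`-block. [folklore] -/
theorem oblkX_apply (T : ι → ι → ι → R) (v : Tri ι) (pq : ι × ι) :
    oblkX T v pq = if v.1 = pq.1 then T pq.2 v.2.1 v.2.2 else 0 := by
  rcases v with ⟨a, b, c⟩
  rcases pq with ⟨p, q⟩
  simp only [oblkX, flat, Matrix.kronecker_apply, Matrix.one_apply, Matrix.transpose_apply,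
    Matrix.of_apply, boole_mul]

/-- Swap of the first two tensor factors. [folklore] -/
def swapXY (T : ι → ι → ι → R) : ι → ι → ι → R := fun a b c => T b a c

/-- The index swap `(a,b,c) ↦ (b,a,c)`. [folklore] -/
def σXY : Tri ι ≃ Tri ι where
  toFun v := (v.2.1, v.1, v.2.2)
  invFun v := (v.2.1, v.1, v.2.2)
  left_inv _ := rfl
  right_inv _ := rfl

/-- Pointwise form of `σXY`. [folklore] -/
@[simp] theorem σXY_apply (v : Tri ι) : σXY v = (v.2.1, v.1, v.2.2) := rfl

/-- `σXY` is an involution. [folklore] -/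
theorem σXY_symm : (σXY : Tri ι ≃ Tri ι).symm = σXY := rfl

/-- The factor swap is an involution. [folklore] -/
theorem swapXY_swapXY (T : ι → ι → ι → R) : swapXY (swapXY T) = T := rfl

/-- The `Y`-block: column `(p, q)` is `E_{pq} ·₂ T`. [folklore] -/
def oblkY (T : ι → ι → ι → R) : Matrix (Tri ι) (ι × ι) R := (oblkX (swapXY T)).submatrix σXY id

/-- The two blocks as a family. [folklore] -/
def blk (T : ι → ι → ι → R) : Fin 2 → Matrix (Tri ι) (ι × ι) R := ![oblkX T, oblkY T]

/-- **The orbit form** `O_T` of the first two factors. [folklore] -/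
def orbitForm (T : ι → ι → ι → R) : Matrix (Tri ι) (Col ι) R := fun v w => blk T w.1 v w.2

/-- Explicit entries of `O_T`. [folklore] -/
theorem orbitForm_apply (T : ι → ι → ι → R) (v : Tri ι) (w : Col ι) :
    orbitForm T v w =
      if w.1 = 0 then (if v.1 = w.2.1 then T w.2.2 v.2.1 v.2.2 else 0)
      else (if v.2.1 = w.2.1 then T v.1 w.2.2 v.2.2 else 0) := by
  rcases w with ⟨f, p, q⟩
  fin_cases f <;> simp [orbitForm, blk, oblkY, oblkX_apply, swapXY]

/-- `O` is additive in `T`. [folklore] -/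
theorem orbitForm_add (T T' : ι → ι → ι → R) : orbitForm (T + T') = orbitForm T + orbitForm T' := by
  ext v w
  simp only [orbitForm_apply, Matrix.add_apply, Pi.add_apply]
  split_ifs <;> simp

/-- `O` is homogeneous in `T`. [folklore] -/
theorem orbitForm_smul (c : R) (T : ι → ι → ι → R) : orbitForm (c • T) = c • orbitForm T := by
  ext v w
  simp only [orbitForm_apply, Matrix.smul_apply, Pi.smul_apply, smul_eq_mul]
  split_ifs <;> simp

/-- `O` commutes with ring maps. [folklore] -/
theorem orbitForm_map {S : Type*} [CommRing S] (f : R →+* S) (T : ι → ι → ι → R) :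
    (orbitForm T).map f = orbitForm (fun a b c => f (T a b c)) := by
  ext v w
  simp only [orbitForm_apply, Matrix.map_apply]
  split_ifs <;> simp

/-- Integer tensors read in `R`. [folklore] -/
theorem orbitForm_map_intCast (N : ι → ι → ι → ℤ) :
    (orbitForm N).map (Int.cast : ℤ → R) = orbitForm (fun a b c => (N a b c : R)) := by
  ext v w
  simp only [orbitForm_apply, Matrix.map_apply]
  split_ifs <;> simp

/-- Entrywise form of `orbitForm_map_intCast`. [folklore] -/
theorem orbitForm_intCast (N : ι → ι → ι → ℤ) (v : Tri ι) (w : Col ι) :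
    orbitForm (fun a b c => (N a b c : R)) v w = ((orbitForm N v w : ℤ) : R) := by
  rw [← orbitForm_map_intCast, Matrix.map_apply]

/-! ## Equivariance -/

/-- The flattening of the substituted tensor. [folklore] -/
theorem flat_tsub (T : ι → ι → ι → R) (A B C : ι → ι → R) :
    flat (tsub T A B C) = (Matrix.of A)ᵀ * flat T * (Matrix.of B ⊗ₖ Matrix.of C) := by
  ext q bc
  rcases bc with ⟨b, c⟩
  simp only [flat, tsub, Matrix.mul_apply, Matrix.of_apply, Matrix.transpose_apply,
    Matrix.kronecker_apply, Fintype.sum_prod_type, Finset.sum_mul]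
  refine Finset.sum_comm.trans (Finset.sum_congr rfl fun y _ => ?_)
  refine Finset.sum_comm.trans (Finset.sum_congr rfl fun z _ => Finset.sum_congr rfl fun x _ => ?_)
  ring

/-- Substitution commutes with the swap of the first two factors. [folklore] -/
theorem tsub_swapXY (T : ι → ι → ι → R) (A B C : ι → ι → R) :
    tsub (swapXY T) B A C = swapXY (tsub T A B C) := by
  funext a b c
  simp only [tsub, swapXY]
  exact Fintype.sum_equiv σXY _ _ fun v => by simp only [σXY_apply]; ring

/-- The transposed Kronecker cube `(A ⊗ B ⊗ C)ᵀ`. [folklore] -/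
def kronT (A B C : ι → ι → R) : Matrix (Tri ι) (Tri ι) R :=
  (Matrix.of A ⊗ₖ (Matrix.of B ⊗ₖ Matrix.of C))ᵀ

/-- The block of `Φ` for a factor matrix `M`: `X ↦ adj(Mᵀ) X M` on coordinates. [folklore] -/
def phiBlk (M : ι → ι → R) : Matrix (ι × ι) (ι × ι) R := (Matrix.of M)ᵀ.adjugate ⊗ₖ Matrix.of M

/-- **Block `X` equivariance**: `(A⊗B⊗C)ᵀ · O^X_T · (adj Aᵀ ⊗ A) = det A · O^X_{(A,B,C)·T}`.
[folklore] -/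
theorem kronT_mul_oblkX_mul (T : ι → ι → ι → R) (A B C : ι → ι → R) :
    kronT A B C * oblkX T * phiBlk A = (Matrix.of A).det • oblkX (tsub T A B C) := by
  rw [kronT, phiBlk, oblkX, oblkX, flat_tsub, ← Matrix.kroneckerMap_transpose,
    ← Matrix.mul_kronecker_mul, ← Matrix.mul_kronecker_mul, Matrix.mul_one, Matrix.mul_adjugate,
    Matrix.det_transpose, Matrix.smul_kronecker, Matrix.transpose_mul, Matrix.transpose_mul,
    Matrix.transpose_transpose, Matrix.mul_assoc]

/-- Permuting factors in the Kronecker cube (`X ↔ Y`). [folklore] -/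
theorem kronT_eq_submatrix_swapXY (A B C : ι → ι → R) :
    kronT A B C = (kronT B A C).submatrix σXY σXY := by
  ext v w
  rcases v with ⟨a, b, c⟩
  rcases w with ⟨x, y, z⟩
  simp only [kronT, Matrix.transpose_apply, Matrix.submatrix_apply, Matrix.kronecker_apply,
    Matrix.of_apply, σXY_apply]
  ring

/-- **Block `Y` equivariance.** [folklore] -/
theorem kronT_mul_oblkY_mul (T : ι → ι → ι → R) (A B C : ι → ι → R) :
    kronT A B C * oblkY T * phiBlk B = (Matrix.of B).det • oblkY (tsub T A B C) := by
  have h1 : kronT A B C * oblkY T = (kronT B A C * oblkX (swapXY T)).submatrix σXY id := by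
    rw [kronT_eq_submatrix_swapXY, oblkY, Matrix.submatrix_mul_equiv]
  have h2 : (kronT B A C * oblkX (swapXY T)).submatrix (σXY : Tri ι → Tri ι) id * phiBlk B =
      (kronT B A C * oblkX (swapXY T) * phiBlk B).submatrix σXY id := by
    rw [Matrix.submatrix_mul _ (phiBlk B) _ id _ Function.bijective_id, Matrix.submatrix_id_id]
  rw [h1, h2, kronT_mul_oblkX_mul, tsub_swapXY, Matrix.submatrix_smul]
  rfl

/-- Blockwise equivariance. [folklore] -/
theorem kronT_mul_blk_mul (T : ι → ι → ι → R) (A B C : ι → ι → R) (f : Fin 2) :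
    kronT A B C * blk T f * ![phiBlk A, phiBlk B] f =
      (![Matrix.of A, Matrix.of B] f).det • blk (tsub T A B C) f := by
  fin_cases f
  · exact kronT_mul_oblkX_mul T A B C
  · exact kronT_mul_oblkY_mul T A B C

/-- The change of coordinates on `gl ⊕ gl`: block-diagonal `Φ`. [folklore] -/
def Phi (A B : ι → ι → R) : Matrix (Col ι) (Col ι) R :=
  fun w w' => if w.1 = w'.1 then ![phiBlk A, phiBlk B] w'.1 w.2 w'.2 else 0

/-- The block scalars `det M_f`. [folklore] -/
def dets (A B : ι → ι → R) : Col ι → R := fun w => (![Matrix.of A, Matrix.of B] w.1).det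

/-- **Equivariance of the orbit form**: `(A⊗B⊗C)ᵀ · O_T · Φ = O_{(A,B,C)·T} · diag(det)`.
[folklore] -/
theorem kronT_mul_orbitForm_mul (T : ι → ι → ι → R) (A B C : ι → ι → R) :
    kronT A B C * orbitForm T * Phi A B =
      orbitForm (tsub T A B C) * Matrix.diagonal (dets A B) := by
  ext v w'
  rcases w' with ⟨f, pq⟩
  have key := congrFun (congrFun (kronT_mul_blk_mul T A B C f) v) pq
  simp only [Matrix.mul_apply, Matrix.smul_apply, smul_eq_mul] at key
  have eR : (orbitForm (tsub T A B C) * Matrix.diagonal (dets A B)) v (f, pq) =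
      (![Matrix.of A, Matrix.of B] f).det * blk (tsub T A B C) f v pq := by
    rw [Matrix.mul_diagonal]
    exact mul_comm _ _
  rw [eR, ← key, Matrix.mul_apply, Fintype.sum_prod_type]
  simp only [Phi, mul_ite, mul_zero]
  rw [Finset.sum_comm]
  simp only [Finset.sum_ite_eq', Finset.mem_univ, if_true]
  refine Finset.sum_congr rfl fun pq' _ => ?_
  simp only [Matrix.mul_apply]
  rfl

end Form

/-! ## Rank under substitution and degeneration -/

section Rank

variable {F : Type*} [Field F]

/-- Substitutions invertible in the first two factors do not increase `rank O`. [folklore] -/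
theorem rank_orbitForm_tsub_le (T : ι → ι → ι → F) (A B C : ι → ι → F)
    (hA : (Matrix.of A).det ≠ 0) (hB : (Matrix.of B).det ≠ 0) :
    (orbitForm (tsub T A B C)).rank ≤ (orbitForm T).rank := by
  have hD : IsUnit (Matrix.diagonal (dets A B)).det := by
    rw [Matrix.det_diagonal, isUnit_iff_ne_zero]
    refine Finset.prod_ne_zero_iff.2 fun w _ => ?_
    rcases w with ⟨f, pq⟩
    fin_cases f
    · exact hA
    · exact hB
  calc (orbitForm (tsub T A B C)).rank
      = (orbitForm (tsub T A B C) * Matrix.diagonal (dets A B)).rank :=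
        (Matrix.rank_mul_eq_left_of_isUnit_det _ _ hD).symm
    _ = (kronT A B C * orbitForm T * Phi A B).rank := by rw [kronT_mul_orbitForm_mul]
    _ ≤ (kronT A B C * orbitForm T).rank := Matrix.rank_mul_le_left _ _
    _ ≤ (orbitForm T).rank := Matrix.rank_mul_le_right _ _

end Rank

section Degeneration

variable {K : Type u} [Field K]

/-- `A + y · 1` on substitution maps. [folklore] -/
noncomputable def pert (y : K[X]) (A : ι → ι → K[X]) : ι → ι → K[X] :=
  fun x a => A x a + if x = a then y else 0

/-- The perturbed substitution changes the substituted tensor by a multiple of `y`. [folklore] -/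
theorem polySubst_pert (t : ι → ι → ι → K) (A B C : ι → ι → K[X]) (y : K[X]) (a b c : ι) :
    ∃ q, polySubst t (pert y A) (pert y B) (pert y C) a b c = polySubst t A B C a b c + y * q := by
  refine ⟨∑ x, ∑ x', ∑ x'', Polynomial.C (t x x' x'') *
    ((if x = a then 1 else 0) * pert y B x' b * pert y C x'' c +
      A x a * (if x' = b then 1 else 0) * pert y C x'' c +
      A x a * B x' b * (if x'' = c then 1 else 0)), ?_⟩
  simp only [polySubst, pert, Finset.mul_sum, ← Finset.sum_add_distrib]
  refine Finset.sum_congr rfl fun x _ => Finset.sum_congr rfl fun x' _ =>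
    Finset.sum_congr rfl fun x'' _ => ?_
  split_ifs <;> ring

/-- `det (A + y·1)` is the characteristic polynomial of `-A` evaluated at `y`. [folklore] -/
theorem det_pert (A : ι → ι → K[X]) (y : K[X]) :
    (Matrix.of (pert y A)).det = (-Matrix.of A).charpoly.eval y := by
  rw [Matrix.charpoly, ← Polynomial.coe_evalRingHom, RingHom.map_det]
  congr 1
  ext i j : 1
  simp only [RingHom.mapMatrix_apply, Matrix.map_apply, Polynomial.coe_evalRingHom,
    Matrix.charmatrix_apply, Matrix.diagonal_apply, Matrix.neg_apply, Matrix.of_apply, pert]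
  split_ifs <;> simp [add_comm]

/-- **One exponent works for all three matrices**: among `y = X^m, …, X^{m+3|ι|}` one makes
`det (A + y·1), det (B + y·1), det (C + y·1)` all non-zero. [folklore] -/
theorem exists_pert_det_ne_zero (A B C : ι → ι → K[X]) (m : ℕ) :
    ∃ i < 3 * Fintype.card ι + 1, (Matrix.of (pert (X ^ (m + i)) A)).det ≠ 0 ∧
      (Matrix.of (pert (X ^ (m + i)) B)).det ≠ 0 ∧ (Matrix.of (pert (X ^ (m + i)) C)).det ≠ 0 := by
  classical
  set Q : K[X][X] := (-Matrix.of A).charpoly * (-Matrix.of B).charpoly * (-Matrix.of C).charpoly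
    with hQ
  have hQm : Q.Monic :=
    ((Matrix.charpoly_monic _).mul (Matrix.charpoly_monic _)).mul (Matrix.charpoly_monic _)
  have hQdeg : Q.natDegree = 3 * Fintype.card ι := by
    rw [hQ, ((Matrix.charpoly_monic _).mul (Matrix.charpoly_monic _)).natDegree_mul
      (Matrix.charpoly_monic _), (Matrix.charpoly_monic _).natDegree_mul (Matrix.charpoly_monic _)]
    simp only [Matrix.charpoly_natDegree_eq_dim]
    ring
  suffices h : ∃ i < 3 * Fintype.card ι + 1, ¬ Q.IsRoot (X ^ (m + i)) by
    obtain ⟨i, hi, hroot⟩ := h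
    refine ⟨i, hi, ?_⟩
    rw [Polynomial.IsRoot.def, hQ, Polynomial.eval_mul, Polynomial.eval_mul] at hroot
    rw [det_pert, det_pert, det_pert]
    exact ⟨fun h0 => hroot (mul_eq_zero_of_left (mul_eq_zero_of_left h0 _) _),
      fun h0 => hroot (mul_eq_zero_of_left (mul_eq_zero_of_right _ h0) _),
      fun h0 => hroot (mul_eq_zero_of_right _ h0)⟩
  by_contra hall
  push Not at hall
  have hsub : (Finset.range (3 * Fintype.card ι + 1)).image (fun i => (X : K[X]) ^ (m + i)) ⊆
      Q.roots.toFinset := by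
    intro y hy
    rw [Finset.mem_image] at hy
    obtain ⟨i, hi, rfl⟩ := hy
    rw [Multiset.mem_toFinset, Polynomial.mem_roots hQm.ne_zero]
    exact hall i (Finset.mem_range.1 hi)
  have hcard : ((Finset.range (3 * Fintype.card ι + 1)).image
      (fun i => (X : K[X]) ^ (m + i))).card = 3 * Fintype.card ι + 1 := by
    rw [Finset.card_image_of_injective _ (fun i j hij => ?_), Finset.card_range]
    have := congrArg Polynomial.natDegree hij
    simp only [Polynomial.natDegree_X_pow] at this
    omega
  have := (Finset.card_le_card hsub).trans
    ((Multiset.toFinset_card_le (m := Q.roots)).trans (Polynomial.card_roots' Q))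
  rw [hcard, hQdeg] at this
  omega

/-- **Semicontinuity of `rank O` under degeneration**: if the integer tensor `S` degenerates to `N`
over `K` and `rank O_S ≤ r` over every field receiving `K`, then `rank O_N ≤ r`.
[cite: Alman2021, §2.4] -/
theorem rank_orbitForm_le_of_polyDegeneratesTo (S : ι → ι → ι → ℤ) {N : ι → ι → ι → K}
    (hSN : PolyDegeneratesTo (fun a b c => (S a b c : K)) N) {r : ℕ}
    (hS : ∀ (L : Type u) [Field L], (K →+* L) → (orbitForm (fun a b c => (S a b c : L))).rank ≤ r) :
    (orbitForm N).rank ≤ r := by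
  classical
  obtain ⟨h, A, B, C, hABC⟩ := hSN
  obtain ⟨i, -, hA, hB, -⟩ := exists_pert_det_ne_zero A B C (h + 1)
  set y : K[X] := X ^ (h + 1 + i) with hy
  set s : ι → ι → ι → K := fun a b c => (S a b c : K) with hs
  set T := polySubst s (pert y A) (pert y B) (pert y C) with hT
  have hTc : ∀ a b c, ∀ j ≤ h, (T a b c).coeff j = if j = h then N a b c else 0 := by
    intro a b c j hj
    obtain ⟨q, hq⟩ := polySubst_pert s A B C y a b c
    rw [hT, hq, Polynomial.coeff_add, hy, Polynomial.coeff_X_pow_mul', if_neg (by omega), add_zero]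
    exact hABC a b c j hj
  have hdvd : ∀ a b c, X ^ (h + 1) ∣ T a b c - Polynomial.C (N a b c) * X ^ h := by
    intro a b c
    rw [Polynomial.X_pow_dvd_iff]
    intro d hd
    rw [Polynomial.coeff_sub, Polynomial.coeff_C_mul_X_pow, hTc a b c d (by omega)]
    split_ifs <;> simp
  choose T' hT' using hdvd
  have hTe : T = (X : K[X]) ^ h • ((fun a b c => Polynomial.C (N a b c)) + (X : K[X]) • T') := by
    funext a b c
    simp only [Pi.smul_apply, Pi.add_apply, smul_eq_mul]
    linear_combination hT' a b c
  have hKF : orbitForm T = (X : K[X]) ^ h •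
      ((orbitForm N).map (Polynomial.C : K →+* K[X]) + (X : K[X]) • orbitForm T') := by
    rw [hTe, orbitForm_smul, orbitForm_add, orbitForm_smul, orbitForm_map]
  have hN : ∀ p q, orbitForm T p q =
      (Polynomial.C (orbitForm N p q) + X * orbitForm T' p q) * X ^ h := by
    intro p q
    rw [hKF]
    simp only [Matrix.smul_apply, Matrix.add_apply, Matrix.map_apply, smul_eq_mul]
    ring
  let L := FractionRing K[X]
  have key := rank_le_rank_map_of_perturbation (L := L) (orbitForm N) (orbitForm T')
    (orbitForm T) h hN
  set φ := algebraMap K[X] L with hφ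
  have hinj : Function.Injective φ := IsFractionRing.injective K[X] L
  have hmapT : (fun a b c => φ (T a b c)) = tsub (fun a b c => (S a b c : L))
      (fun x a => φ (pert y A x a)) (fun x a => φ (pert y B x a))
      (fun x a => φ (pert y C x a)) := by
    funext a b c
    simp only [hT, polySubst_eq_tsub, tsub, hs, map_sum, map_mul, map_intCast]
  have hdet' : ∀ {M : ι → ι → K[X]}, (Matrix.of M).det ≠ 0 →
      (Matrix.of fun x a => φ (M x a)).det ≠ 0 := by
    intro M hM
    have e : (Matrix.of fun x a => φ (M x a)) = φ.mapMatrix (Matrix.of M) := by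
      ext i j; rfl
    rw [e, ← RingHom.map_det]
    exact (map_ne_zero_iff φ hinj).2 hM
  have hbound : ((orbitForm T).map φ).rank ≤ r := by
    rw [orbitForm_map, hmapT]
    exact (rank_orbitForm_tsub_le _ _ _ _ (hdet' hA) (hdet' hB)).trans (hS L (φ.comp Polynomial.C))
  exact key.trans hbound

end Degeneration

end OrbitRankGen

end Summit.MatrixMultiplication.MatrixMultiplication.Theorems
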